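import Literature.MathematicalPhysics.QuantumLattice.HubbardGridFlowParameters
import Literature.MathematicalPhysics.QuantumLattice.GrassmannFlowScalarClosure
import HarnessLib

/-!
# The budget of the multiscale flow of the Hubbard torus at `βU ≤ κ`: every `θ_j` stays below `1/30`

Topic `MathematicalPhysics/QuantumLattice`; cell gate-hubbard-kl, R0-SCOPE-4 W7 (the inequality half of the closure).  The data of a run of
the flow are bundled in `FlowSetup` (constants `C_uv, C_sl, A, κ₀, τ₀, κ_U`, parameters `β, μ_R, θ, Λ₀, K`, couplings `u, ν₀`); its
semantic hypotheses in `FlowSetup.Valid` (Gram constants `κ_j`, row sums `α_j`, slice tadpoles `≤ AΛ_j`, the Hartree residual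
`‖ν₀ + uΣt_i‖ ≤ ‖u‖π/β`, `‖ν₀‖ ≤ τ₀‖u‖`, `‖u‖ ≤ κ_U/β`, and the two smallness conditions on `κ_U`).  With `a_j = eα_j/κ_j²`,
`σ_j = a_j Λn_j` (tracked part), `U_j = a_j g P_j` (pollution; `P_j` the quadratic budget `FlowSetup.P`), `Θ_j = σ_j + U_j`:

* `FlowSetup.sigma_zero_le`, `FlowSetup.sigma_le` — `σ_0 ≤ E₄‖u‖`, `σ_j ≤ E₂‖u‖/√Λ_j`;
* `FlowSetup.U_succ` — `U_{j+1} = (e g a_{j+1}/a_j)(U_j + Θ_j²/(1-ε))`, with `a_{j+1}/a_j = r^{5/2}` on the slices;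
* `FlowSetup.U_le` — the geometric invariant `U_j ≤ Γ′^{j-1}(Ū₁ + W)`, `Γ′ = (11/10) e g r^{5/2} ≤ (3/5) r²`, hence `U_j ≤ κ_U² E₆ ≤ 1/60`;
* **`FlowSetup.theta_le`** — `Θ_j ≤ ε = 1/30` for all `j ≤ K`, i.e. hypothesis `hsmall` of `flowD_budget_quadratic`
  (Benfatto–Giuliani–Mastropietro 2006, §2.8 (2.85)–(2.88): the inductive bounds close because the source is quadratic in the running
  coupling and the dimensional gain per scale beats the combinatorial loss).

Everything is proved; `FlowSetup`, its projections/abbreviations and `FlowSetup.Valid` are the only definitions; no named facts.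

## Sources

G. Benfatto, A. Giuliani, V. Mastropietro, Ann. Henri Poincaré 7 (2006) 809–898, §2.8 (2.80)–(2.88) (`BenfattoGiulianiMastropietro2006`).
-/

noncomputable section

namespace Literature.MathematicalPhysics.QuantumLattice

open Literature.Probability.LatticeModels GrassmannAlgebra Finset Complex

/-- **The data of a run of the flow.** [cite: BenfattoGiulianiMastropietro2006, §2.8 (2.85)-(2.88)] -/
structure FlowSetup (L M N : ℕ) : Type where
  /-- row-sum constant of the ultraviolet block (`α_0 = C_uv N/β`) -/
  Cuv : ℝ
  /-- row-sum constant of the slices (`α_j = C_sl (N/β) Λ_j^{-3/2}`) -/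
  Csl : ℝ
  /-- Gram constant of the slices (`κ_j² = A Λ_j`, `‖t_j‖ ≤ A Λ_j`) -/
  A : ℝ
  /-- Gram constant of the ultraviolet block -/
  κ₀ : ℝ
  /-- `‖ν₀‖ ≤ τ₀ ‖u‖` -/
  τ₀ : ℝ
  /-- `‖u‖ ≤ κ_U/β` -/
  κU : ℝ
  /-- inverse temperature -/
  β : ℝ
  /-- real part of the shifted chemical potential -/
  μR : ℝ
  /-- imaginary part of the shifted chemical potential -/
  θ : ℝ
  /-- infrared scale of the ultraviolet block -/
  Λ₀ : ℝ
  /-- number of infrared scales -/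
  K : ℕ
  /-- the (complex) coupling -/
  u : ℂ
  /-- the initial quadratic coupling (Hartree counterterm) -/
  ν₀ : ℂ

namespace FlowSetup

variable {L M N : ℕ} [NeZero L] [NeZero N] (S : FlowSetup L M N)

/-- The scales. [cite: BenfattoGiulianiMastropietro2006, §2.2 (2.9)] -/
abbrev scale (j : ℕ) : ℝ := gridScale S.β S.Λ₀ flowR S.K j
/-- The covariances. [cite: BenfattoGiulianiMastropietro2006, §2.2 (2.12)] -/
abbrev cov (j : ℕ) : Matrix (GridLeg (GridPoint L N)) (GridLeg (GridPoint L N)) ℂ :=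
  gridScaleCov L M N S.β S.μR S.θ S.Λ₀ flowR S.K j
/-- The tadpoles. [cite: BenfattoGiulianiMastropietro2006, §2.3 (2.21)] -/
abbrev tad (j : ℕ) : ℂ := gridScaleTadpole L M S.β S.μR S.θ S.Λ₀ flowR S.K j
/-- The Gram constants. [cite: BenfattoGiulianiMastropietro2006, §2.8 (2.80)] -/
abbrev kap (j : ℕ) : ℝ := flowKap S.A S.κ₀ S.β S.Λ₀ S.K j
/-- The field radii. [cite: BenfattoGiulianiMastropietro2006, §2.8 (2.85)] -/
abbrev rho (j : ℕ) : ℝ := flowRho S.A S.κ₀ S.β S.Λ₀ S.K j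
/-- The deviation weights. [cite: BenfattoGiulianiMastropietro2006, §2.8 (2.85)] -/
abbrev t (j : ℕ) : ℝ := flowT S.A S.κ₀ S.β S.Λ₀ S.K j
/-- The tracked couplings. [cite: BenfattoGiulianiMastropietro2006, §2.8 (2.86)] -/
abbrev nu (j : ℕ) : ℂ := flowNu L M S.β S.μR S.θ S.Λ₀ S.K S.u S.ν₀ j

/-- **The row-sum constants** `α_0 = C_uv N/β`, `α_j = C_sl (N/β)/(Λ_j√Λ_j)`, `1` beyond `K`. [cite: BenfattoGiulianiMastropietro2006, §2.8 (2.81)] -/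
def alp (j : ℕ) : ℝ :=
  if j = 0 then S.Cuv * (N / S.β) else if j ≤ S.K then S.Csl * (N / S.β) / (S.scale j * Real.sqrt (S.scale j)) else 1

/-- The pinned norms of the tracked part. [cite: BenfattoGiulianiMastropietro2006, §2.8 (2.86)] -/
abbrev NL (j m : ℕ) : ℝ := gridTrackedNL N S.β S.u (S.nu j) m

/-- **The field-weighted size of the tracked part** `Λn_j = ‖L_j‖_{h_j}`. [cite: BenfattoGiulianiMastropietro2006, §2.8 (2.86)] -/
def lam (j : ℕ) : ℝ := normV (GridLeg (GridPoint L N)) (S.kap j) (S.rho j) fun m' => S.NL j (2 * m')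

/-- **The quadratic pollution budget** `P_0 = 0`,
`P_{j+1} = e (g P_j + (Λn_j + g P_j) Θ_j/(1-ε))`, `Θ_j = e α_j (Λn_j + g P_j)/κ_j²` (written with `g P = P x̄²/(1-x̄²)`).
[cite: BenfattoGiulianiMastropietro2006, §2.8 (2.88)] -/
def P : ℕ → ℝ
  | 0 => 0
  | j + 1 => Real.exp 1 * (P j * flowX ^ 2 / (1 - flowX ^ 2) + (S.lam j + P j * flowX ^ 2 / (1 - flowX ^ 2)) *
      (Real.exp 1 * S.alp j * (S.lam j + P j * flowX ^ 2 / (1 - flowX ^ 2)) / S.kap j ^ 2) / (1 - flowEps))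

omit [NeZero N] in
/-- `P_0 = 0`. [cite: BenfattoGiulianiMastropietro2006, §2.8 (2.88)] -/
@[simp] theorem P_zero : S.P 0 = 0 := rfl

omit [NeZero N] in
/-- The budget step. [cite: BenfattoGiulianiMastropietro2006, §2.8 (2.88)] -/
theorem P_succ (j : ℕ) : S.P (j + 1) = Real.exp 1 * (S.P j * flowX ^ 2 / (1 - flowX ^ 2) + (S.lam j + S.P j * flowX ^ 2 / (1 - flowX ^ 2)) *
      (Real.exp 1 * S.alp j * (S.lam j + S.P j * flowX ^ 2 / (1 - flowX ^ 2)) / S.kap j ^ 2) / (1 - flowEps)) := rfl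

/-- `a_j = e α_j/κ_j²`. [cite: BenfattoGiulianiMastropietro2006, §2.8 (2.88)] -/
def a (j : ℕ) : ℝ := Real.exp 1 * S.alp j / S.kap j ^ 2

/-- The budgeted `Θ_j = a_j (Λn_j + g P_j)`. [cite: BenfattoGiulianiMastropietro2006, §2.8 (2.88)] -/
def Theta (j : ℕ) : ℝ := S.a j * (S.lam j + flowG * S.P j)

/-- The pollution `U_j = a_j g P_j`. [cite: BenfattoGiulianiMastropietro2006, §2.8 (2.88)] -/
def U (j : ℕ) : ℝ := S.a j * flowG * S.P j

/-- `E₁ = 4e⁴A(1+2A) + 16e⁸A²`. [cite: BenfattoGiulianiMastropietro2006, §2.8 (2.88)] -/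
def E₁ : ℝ := 4 * Real.exp 4 * S.A * (1 + 2 * S.A) + 16 * Real.exp 8 * S.A ^ 2
/-- `E₂ = e C_sl E₁/A`. [cite: BenfattoGiulianiMastropietro2006, §2.8 (2.88)] -/
def E₂ : ℝ := Real.exp 1 * S.Csl * S.E₁ / S.A
/-- `W̄₀ = e²(κ₀ + √r √(AΛ₀))`. [cite: BenfattoGiulianiMastropietro2006, §2.8 (2.88)] -/
def W0 : ℝ := Real.exp 2 * (S.κ₀ + flowSqr * Real.sqrt (S.A * S.Λ₀))
/-- `E₄ = (e C_uv/κ₀²)(W̄₀² τ₀ + W̄₀⁴)`. [cite: BenfattoGiulianiMastropietro2006, §2.8 (2.88)] -/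
def E₄ : ℝ := Real.exp 1 * S.Cuv / S.κ₀ ^ 2 * (S.W0 ^ 2 * S.τ₀ + S.W0 ^ 4)
/-- `Γ̄₀ = e g C_sl κ₀² r²√r/(C_uv A Λ₀²√Λ₀)` (bound of the first growth factor). [cite: BenfattoGiulianiMastropietro2006, §2.8 (2.88)] -/
def Gam0 : ℝ := Real.exp 1 * flowG * S.Csl * S.κ₀ ^ 2 * (flowR ^ 2 * flowSqr) / (S.Cuv * S.A * (S.Λ₀ ^ 2 * Real.sqrt S.Λ₀))
/-- `E₆ = (Λ₀/π)²(30/29)Γ̄₀E₄² + (60/11)E₂²Λ₀r/π²`. [cite: BenfattoGiulianiMastropietro2006, §2.8 (2.88)] -/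
def E₆ : ℝ := (S.Λ₀ / Real.pi) ^ 2 * (30 / 29 * S.Gam0 * S.E₄ ^ 2) + 60 / 11 * S.E₂ ^ 2 * S.Λ₀ * flowR / Real.pi ^ 2

/-- **The hypotheses of a run of the flow.** [cite: BenfattoGiulianiMastropietro2006, §2.8 (2.85)-(2.88)] -/
structure Valid : Prop where
  one_le_β : 1 ≤ S.β
  Cuv_pos : 0 < S.Cuv
  Csl_pos : 0 < S.Csl
  A_pos : 0 < S.A
  κ₀_pos : 0 < S.κ₀
  τ₀_nonneg : 0 ≤ S.τ₀
  κU_nonneg : 0 ≤ S.κU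
  Λ₀_le_one : S.Λ₀ ≤ 1
  K_ne_zero : S.K ≠ 0
  pi_div_le : Real.pi / S.β ≤ S.Λ₀
  top_le : S.scale 1 ≤ S.Λ₀
  le_top : S.Λ₀ ≤ flowR * S.scale 1
  gram : ∀ j, IsGramBoundedR (S.cov j) (S.kap j)
  rows : ∀ j X, ∑ Y, ‖S.cov j X Y‖ ≤ S.alp j
  cols : ∀ j Y, ∑ X, ‖S.cov j X Y‖ ≤ S.alp j
  tad_le : ∀ j, j ≠ 0 → j ≤ S.K → ‖S.tad j‖ ≤ S.A * S.scale j
  res : ‖S.ν₀ + S.u * ∑ i ∈ range (S.K + 1), S.tad i‖ ≤ ‖S.u‖ * (Real.pi / S.β)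
  nu0 : ‖S.ν₀‖ ≤ S.τ₀ * ‖S.u‖
  u_le : ‖S.u‖ ≤ S.κU / S.β
  small₁ : S.κU * (S.E₄ + S.E₂ / Real.sqrt Real.pi) ≤ 1 / 60
  small₂ : S.κU ^ 2 * S.E₆ ≤ 1 / 60

variable {S}

/-! ### Positivity and the basic identities -/

omit [NeZero N] in
/-- Bookkeeping (positivity / algebra of the budget). [cite: BenfattoGiulianiMastropietro2006, §2.8 (2.88)] -/
theorem Valid.β_pos (h : S.Valid) : 0 < S.β := lt_of_lt_of_le one_pos h.one_le_β

omit [NeZero N] in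
/-- Bookkeeping (positivity / algebra of the budget). [cite: BenfattoGiulianiMastropietro2006, §2.8 (2.88)] -/
theorem Valid.Λ₀_pos (h : S.Valid) : 0 < S.Λ₀ := lt_of_lt_of_le (by have := h.β_pos; positivity) h.pi_div_le

omit [NeZero N] in
/-- `Λ_j > 0` for every `j ≤ K`. [cite: BenfattoGiulianiMastropietro2006, §2.2 (2.9)] -/
theorem Valid.scale_pos (h : S.Valid) (j : ℕ) : 0 < S.scale j := by
  rcases Nat.eq_zero_or_pos j with rfl | hj
  · rw [scale, gridScale_zero]; exact h.Λ₀_pos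
  · exact lt_of_lt_of_le (by have := h.β_pos; positivity) (pi_div_le_gridScale h.β_pos S.Λ₀ S.K (by omega))

omit [NeZero N] in
/-- Bookkeeping (positivity / algebra of the budget). [cite: BenfattoGiulianiMastropietro2006, §2.8 (2.88)] -/
theorem Valid.kap_pos (h : S.Valid) (j : ℕ) : 0 < S.kap j := flowKap_pos h.A_pos h.κ₀_pos h.β_pos j
omit [NeZero N] in
/-- Bookkeeping (positivity / algebra of the budget). [cite: BenfattoGiulianiMastropietro2006, §2.8 (2.88)] -/
theorem Valid.rho_pos (h : S.Valid) (j : ℕ) : 0 < S.rho j := flowRho_pos h.A_pos h.κ₀_pos h.β_pos j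
omit [NeZero N] in
/-- Bookkeeping (positivity / algebra of the budget). [cite: BenfattoGiulianiMastropietro2006, §2.8 (2.88)] -/
theorem Valid.t_pos (h : S.Valid) (j : ℕ) : 0 < S.t j := flowT_pos h.A_pos h.κ₀_pos h.β_pos j

/-- `α_j > 0`. [cite: BenfattoGiulianiMastropietro2006, §2.8 (2.81)] -/
theorem Valid.alp_pos (h : S.Valid) (j : ℕ) : 0 < S.alp j := by
  have := h.β_pos; have := h.Cuv_pos; have := h.Csl_pos
  have hN : (0 : ℝ) < N := by exact_mod_cast Nat.pos_of_ne_zero (NeZero.ne N)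
  unfold alp; split_ifs
  · positivity
  · have := h.scale_pos j; positivity
  · exact one_pos

/-- `a_j > 0`. [cite: BenfattoGiulianiMastropietro2006, §2.8 (2.88)] -/
theorem Valid.a_pos (h : S.Valid) (j : ℕ) : 0 < S.a j := by
  unfold a; exact div_pos (mul_pos (Real.exp_pos 1) (h.alp_pos j)) (pow_pos (h.kap_pos j) 2)

omit [NeZero N] in
/-- `u ≠ 0`-free bound `‖u‖ ≤ κ_U` (`β ≥ 1`). [cite: BenfattoGiulianiMastropietro2006, §2.8 (2.88)] -/
theorem Valid.norm_u_le (h : S.Valid) : ‖S.u‖ ≤ S.κU :=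
  h.u_le.trans (div_le_self h.κU_nonneg h.one_le_β)

omit [NeZero N] in
/-- `Λn_j ≥ 0`. [cite: BenfattoGiulianiMastropietro2006, §2.8 (2.86)] -/
theorem Valid.lam_nonneg (h : S.Valid) (j : ℕ) : 0 ≤ S.lam j :=
  normV_nonneg (h.kap_pos j).le (h.rho_pos j).le fun _ => gridTrackedNL_nonneg h.β_pos.le _ _ _

/-- **`Λn_j` in closed form.** [cite: BenfattoGiulianiMastropietro2006, §2.8 (2.86)] -/
theorem lam_eq (j : ℕ) : S.lam j = (Real.exp 2 * (S.kap j + S.rho j)) ^ 2 * (‖S.nu j‖ * (S.β / N)) +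
    (Real.exp 2 * (S.kap j + S.rho j)) ^ 4 * (‖S.u‖ * (S.β / N)) :=
  normV_gridTrackedNL four_le_card_gridLeg _ _ _ _ _

/-- `P_j ≥ 0`. [cite: BenfattoGiulianiMastropietro2006, §2.8 (2.88)] -/
theorem Valid.P_nonneg (h : S.Valid) : ∀ j, 0 ≤ S.P j
  | 0 => le_rfl
  | j + 1 => by
    have hP := Valid.P_nonneg h j
    have hg : 0 ≤ flowX ^ 2 / (1 - flowX ^ 2) := div_nonneg (sq_nonneg _) (by linarith [flowX_sq_lt_one])
    have hPg : 0 ≤ S.P j * flowX ^ 2 / (1 - flowX ^ 2) := by rw [mul_div_assoc]; exact mul_nonneg hP hg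
    have hL := h.lam_nonneg j
    have hα := (h.alp_pos j).le
    have hκ := pow_pos (h.kap_pos j) 2
    have hε : 0 < 1 - flowEps := by linarith [flowEps_lt_one]
    rw [P_succ]
    refine mul_nonneg (Real.exp_pos 1).le (add_nonneg hPg (div_nonneg (mul_nonneg (by linarith) ?_) hε.le))
    exact div_nonneg (mul_nonneg (mul_nonneg (Real.exp_pos 1).le hα) (by linarith)) hκ.le

/-- `g P = P x̄²/(1-x̄²)`. [cite: BenfattoGiulianiMastropietro2006, §2.8 (2.88)] -/
theorem flowG_mul (x : ℝ) : flowG * x = x * flowX ^ 2 / (1 - flowX ^ 2) := by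
  rw [flowG]; ring

omit [NeZero N] in
/-- The budgeted `θ` of `flowD_budget_quadratic` is `Θ_j`. [cite: BenfattoGiulianiMastropietro2006, §2.8 (2.88)] -/
theorem Theta_eq (j : ℕ) :
    Real.exp 1 * S.alp j * (S.lam j + S.P j * flowX ^ 2 / (1 - flowX ^ 2)) / S.kap j ^ 2 = S.Theta j := by
  rw [Theta, a, flowG_mul]; ring

omit [NeZero N] in
/-- `Θ_j = σ_j + U_j`. [cite: BenfattoGiulianiMastropietro2006, §2.8 (2.88)] -/
theorem Theta_eq_add (j : ℕ) : S.Theta j = S.a j * S.lam j + S.U j := by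
  rw [Theta, U]; ring

/-- **The pollution recursion**: `U_{j+1} = (e g a_{j+1}/a_j)(U_j + Θ_j²/(1-ε))` (`a_j ≠ 0`). [cite: BenfattoGiulianiMastropietro2006, §2.8 (2.88)] -/
theorem U_succ (h : S.Valid) (j : ℕ) :
    S.U (j + 1) = (Real.exp 1 * flowG * S.a (j + 1) / S.a j) * (S.U j + S.Theta j ^ 2 / (1 - flowEps)) := by
  have hε : (1 : ℝ) - flowEps ≠ 0 := by rw [flowEps]; norm_num
  have hx : (1 : ℝ) - flowX ^ 2 ≠ 0 := by linarith [flowX_sq_lt_one]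
  have hκ := (h.kap_pos j).ne'
  have hκ' := (h.kap_pos (j + 1)).ne'
  have hα := (h.alp_pos j).ne'
  have he : Real.exp 1 ≠ 0 := (Real.exp_pos 1).ne'
  simp only [U, Theta, a, P_succ, flowG]
  field_simp

omit [NeZero N] in
/-- `U_0 = 0`, `Θ_0 = σ_0`. [cite: BenfattoGiulianiMastropietro2006, §2.8 (2.88)] -/
theorem U_zero : S.U 0 = 0 := by simp [U]

/-! ### The growth factors -/

/-- `a_{j+1}/a_j = r²√r` on the slices (`1 ≤ j ≤ K-1`). [cite: BenfattoGiulianiMastropietro2006, §2.8 (2.88)] -/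
theorem a_succ_eq (h : S.Valid) {j : ℕ} (hj : j ≠ 0) (hjK : j + 1 ≤ S.K) :
    S.a (j + 1) = flowR ^ 2 * flowSqr * S.a j := by
  have hβ := h.β_pos
  have hN : (0 : ℝ) < N := by exact_mod_cast Nat.pos_of_ne_zero (NeZero.ne N)
  have hΛ := h.scale_pos (j + 1)
  have hpred : S.scale j = flowR * S.scale (j + 1) := by
    have := gridScale_pred S.β S.Λ₀ (show 2 ≤ j + 1 by omega) hjK
    simpa using this
  have hsq : Real.sqrt (S.scale j) = flowSqr * Real.sqrt (S.scale (j + 1)) := by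
    rw [hpred, Real.sqrt_mul flowR_pos.le, sqrt_flowR]
  simp only [a, alp, if_neg hj, if_neg (Nat.succ_ne_zero j), if_pos hjK, if_pos (show j ≤ S.K by omega), kap,
    flowKap_sq h.A_pos.le hβ hj (show j ≤ S.K by omega), flowKap_sq h.A_pos.le hβ (Nat.succ_ne_zero j) hjK]
  rw [hsq, show gridScale S.β S.Λ₀ flowR S.K j = S.scale j from rfl, hpred]
  have hs := flowSqr_pos; have hr := flowR_pos; have hA := h.A_pos; have hC := h.Csl_pos
  have hsq0 : 0 < Real.sqrt (S.scale (j + 1)) := Real.sqrt_pos.2 hΛ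
  field_simp

/-- `a_1/a_0 ≤ C_sl κ₀² r²√r/(C_uv A Λ₀²√Λ₀)` (`Λ_1 ≥ Λ₀/r`). [cite: BenfattoGiulianiMastropietro2006, §2.8 (2.88)] -/
theorem a_one_le (h : S.Valid) : Real.exp 1 * flowG * S.a 1 / S.a 0 ≤ S.Gam0 := by
  have hβ := h.β_pos
  have hN : (0 : ℝ) < N := by exact_mod_cast Nat.pos_of_ne_zero (NeZero.ne N)
  have hK : 1 ≤ S.K := Nat.one_le_iff_ne_zero.2 h.K_ne_zero
  have hΛ1 := h.scale_pos 1
  have hΛ₀ := h.Λ₀_pos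
  -- `a_1 = e C_sl (N/β)/(A Λ_1²√Λ_1)`, `a_0 = e C_uv (N/β)/κ₀²`
  have ha1 : S.a 1 = Real.exp 1 * S.Csl * (N / S.β) / (S.A * (S.scale 1 ^ 2 * Real.sqrt (S.scale 1))) := by
    simp only [a, alp, one_ne_zero, if_false, if_pos hK, kap, flowKap_sq h.A_pos.le hβ one_ne_zero hK]
    rw [show gridScale S.β S.Λ₀ flowR S.K 1 = S.scale 1 from rfl]
    have := h.A_pos
    field_simp
  have ha0 : S.a 0 = Real.exp 1 * S.Cuv * (N / S.β) / S.κ₀ ^ 2 := by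
    simp only [a, alp, kap, flowKap, if_true]; ring
  -- `Λ₀²√Λ₀ ≤ r²√r · Λ_1²√Λ_1` from `Λ₀ ≤ r Λ_1`
  have hmono : S.Λ₀ ^ 2 * Real.sqrt S.Λ₀ ≤ flowR ^ 2 * flowSqr * (S.scale 1 ^ 2 * Real.sqrt (S.scale 1)) := by
    have h1 : S.Λ₀ ≤ flowR * S.scale 1 := h.le_top
    have h2 : Real.sqrt S.Λ₀ ≤ flowSqr * Real.sqrt (S.scale 1) := by
      rw [← sqrt_flowR, ← Real.sqrt_mul flowR_pos.le]; exact Real.sqrt_le_sqrt h1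
    have h3 : S.Λ₀ ^ 2 ≤ flowR ^ 2 * S.scale 1 ^ 2 := by
      rw [← mul_pow]; exact pow_le_pow_left₀ hΛ₀.le h1 2
    calc S.Λ₀ ^ 2 * Real.sqrt S.Λ₀ ≤ (flowR ^ 2 * S.scale 1 ^ 2) * (flowSqr * Real.sqrt (S.scale 1)) :=
          mul_le_mul h3 h2 (Real.sqrt_nonneg _) (by positivity)
      _ = _ := by ring
  rw [ha1, ha0, Gam0]
  have hpos : 0 < S.scale 1 ^ 2 * Real.sqrt (S.scale 1) := by positivity
  have := h.Cuv_pos; have := h.Csl_pos; have := h.A_pos; have := h.κ₀_pos; have := flowG_pos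
  rw [div_le_div_iff₀ (by positivity) (by positivity)]
  -- both sides are products of positive constants; reduce to `hmono`
  have key : Real.exp 1 * flowG * (Real.exp 1 * S.Csl * (N / S.β) / (S.A * (S.scale 1 ^ 2 * Real.sqrt (S.scale 1)))) *
      (S.Cuv * S.A * (S.Λ₀ ^ 2 * Real.sqrt S.Λ₀)) =
      (Real.exp 1 * flowG * Real.exp 1 * S.Csl * S.Cuv * (N / S.β)) * ((S.Λ₀ ^ 2 * Real.sqrt S.Λ₀) / (S.scale 1 ^ 2 * Real.sqrt (S.scale 1))) := by
    field_simp
  have key2 : Real.exp 1 * flowG * S.Csl * S.κ₀ ^ 2 * (flowR ^ 2 * flowSqr) * (Real.exp 1 * S.Cuv * (N / S.β) / S.κ₀ ^ 2) =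
      (Real.exp 1 * flowG * Real.exp 1 * S.Csl * S.Cuv * (N / S.β)) * (flowR ^ 2 * flowSqr) := by
    field_simp
  rw [key, key2]
  refine mul_le_mul_of_nonneg_left ?_ (by positivity)
  rw [div_le_iff₀ hpos]
  exact hmono

/-! ### The tracked part: `σ_0 ≤ E₄ ‖u‖`, `σ_j ≤ E₂ ‖u‖/√Λ_j` -/

/-- **`σ_0 ≤ E₄ ‖u‖`.** [cite: BenfattoGiulianiMastropietro2006, §2.8 (2.86)-(2.88)] -/
theorem sigma_zero_le (h : S.Valid) : S.a 0 * S.lam 0 ≤ S.E₄ * ‖S.u‖ := by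
  have hβ := h.β_pos
  have hN : (0 : ℝ) < N := by exact_mod_cast Nat.pos_of_ne_zero (NeZero.ne N)
  have hK : 1 ≤ S.K := Nat.one_le_iff_ne_zero.2 h.K_ne_zero
  -- `W_0 = e²(κ₀ + √r κ_1) ≤ W̄₀`
  have hκ1 : S.kap 1 = Real.sqrt (S.A * S.scale 1) := by simp [kap, flowKap, hK]
  have hW : Real.exp 2 * (S.kap 0 + S.rho 0) ≤ S.W0 := by
    have h0 : S.kap 0 = S.κ₀ := by simp [kap, flowKap]
    have hρ : S.rho 0 = flowSqr * S.kap 1 := by simp [rho, flowRho]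
    rw [h0, hρ, hκ1, W0]
    have : Real.sqrt (S.A * S.scale 1) ≤ Real.sqrt (S.A * S.Λ₀) := Real.sqrt_le_sqrt (mul_le_mul_of_nonneg_left h.top_le h.A_pos.le)
    have := flowSqr_pos
    gcongr
  have hW0 : 0 ≤ Real.exp 2 * (S.kap 0 + S.rho 0) := by
    have := h.kap_pos 0; have := h.rho_pos 0; positivity
  have ha0 : S.a 0 = Real.exp 1 * S.Cuv * (N / S.β) / S.κ₀ ^ 2 := by
    simp only [a, alp, kap, flowKap, if_true]; ring
  rw [ha0, lam_eq, show S.nu 0 = S.ν₀ by simp [nu], E₄]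
  have hν := h.nu0
  have hu0 : 0 ≤ ‖S.u‖ := norm_nonneg _
  have h2 : (Real.exp 2 * (S.kap 0 + S.rho 0)) ^ 2 ≤ S.W0 ^ 2 := pow_le_pow_left₀ hW0 hW 2
  have h4 : (Real.exp 2 * (S.kap 0 + S.rho 0)) ^ 4 ≤ S.W0 ^ 4 := pow_le_pow_left₀ hW0 hW 4
  have := h.Cuv_pos; have := h.κ₀_pos; have := h.τ₀_nonneg
  calc Real.exp 1 * S.Cuv * (N / S.β) / S.κ₀ ^ 2 *
        ((Real.exp 2 * (S.kap 0 + S.rho 0)) ^ 2 * (‖S.ν₀‖ * (S.β / N)) + (Real.exp 2 * (S.kap 0 + S.rho 0)) ^ 4 * (‖S.u‖ * (S.β / N)))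
      ≤ Real.exp 1 * S.Cuv * (N / S.β) / S.κ₀ ^ 2 * (S.W0 ^ 2 * (S.τ₀ * ‖S.u‖ * (S.β / N)) + S.W0 ^ 4 * (‖S.u‖ * (S.β / N))) := by
        gcongr
    _ = Real.exp 1 * S.Cuv / S.κ₀ ^ 2 * (S.W0 ^ 2 * S.τ₀ + S.W0 ^ 4) * ‖S.u‖ := by field_simp

/-- **`σ_j ≤ E₂ ‖u‖/√Λ_j`** for `1 ≤ j ≤ K`. [cite: BenfattoGiulianiMastropietro2006, §2.8 (2.86)-(2.88)] -/
theorem sigma_le (h : S.Valid) {j : ℕ} (hj : j ≠ 0) (hjK : j ≤ S.K) :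
    S.a j * S.lam j ≤ S.E₂ * ‖S.u‖ / Real.sqrt (S.scale j) := by
  have hβ := h.β_pos
  have hN : (0 : ℝ) < N := by exact_mod_cast Nat.pos_of_ne_zero (NeZero.ne N)
  have hΛ := h.scale_pos j
  have hsq : 0 < Real.sqrt (S.scale j) := Real.sqrt_pos.2 hΛ
  have hu0 : 0 ≤ ‖S.u‖ := norm_nonneg _
  -- `κ_j² = AΛ_j`, `ρ_j = κ_j`
  have hκ2 : S.kap j ^ 2 = S.A * S.scale j := flowKap_sq h.A_pos.le hβ hj hjK
  have hρ : S.rho j = S.kap j := by simp [rho, flowRho, hj]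
  -- `‖ν_j‖ ≤ ‖u‖ Λ_j (1 + 2A)`
  have hν : ‖S.nu j‖ ≤ ‖S.u‖ * (S.scale j * (1 + 2 * S.A)) := by
    have h1 := norm_flowNu_le (L := L) (M := M) hβ h.K_ne_zero h.A_pos.le h.res h.tad_le hj (by omega)
    rw [Nat.min_eq_left hjK] at h1
    have h2 : Real.pi / S.β ≤ S.scale j := pi_div_le_gridScale hβ S.Λ₀ S.K hj
    calc ‖S.nu j‖ ≤ ‖S.u‖ * (Real.pi / S.β) + ‖S.u‖ * (2 * S.A * S.scale j) := h1
      _ ≤ ‖S.u‖ * S.scale j + ‖S.u‖ * (2 * S.A * S.scale j) := by gcongr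
      _ = ‖S.u‖ * (S.scale j * (1 + 2 * S.A)) := by ring
  -- `Λn_j ≤ E₁ ‖u‖ Λ_j² β/N`
  have hlam : S.lam j ≤ S.E₁ * ‖S.u‖ * S.scale j ^ 2 * (S.β / N) := by
    have he4 : Real.exp 2 ^ 2 = Real.exp 4 := by rw [← Real.exp_nat_mul]; norm_num
    have he8 : Real.exp 2 ^ 4 = Real.exp 8 := by rw [← Real.exp_nat_mul]; norm_num
    rw [lam_eq, hρ, ← two_mul, show (Real.exp 2 * (2 * S.kap j)) ^ 2 = 4 * Real.exp 4 * S.kap j ^ 2 by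
        rw [mul_pow, mul_pow, he4]; ring,
      show (Real.exp 2 * (2 * S.kap j)) ^ 4 = 16 * Real.exp 8 * (S.kap j ^ 2) ^ 2 by
        rw [mul_pow, mul_pow, he8]; ring, hκ2, E₁]
    have hA := h.A_pos
    calc 4 * Real.exp 4 * (S.A * S.scale j) * (‖S.nu j‖ * (S.β / N)) + 16 * Real.exp 8 * (S.A * S.scale j) ^ 2 * (‖S.u‖ * (S.β / N))
        ≤ 4 * Real.exp 4 * (S.A * S.scale j) * (‖S.u‖ * (S.scale j * (1 + 2 * S.A)) * (S.β / N)) +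
          16 * Real.exp 8 * (S.A * S.scale j) ^ 2 * (‖S.u‖ * (S.β / N)) := by gcongr
      _ = (4 * Real.exp 4 * S.A * (1 + 2 * S.A) + 16 * Real.exp 8 * S.A ^ 2) * ‖S.u‖ * S.scale j ^ 2 * (S.β / N) := by ring
  -- `a_j = e C_sl (N/β)/(A Λ_j²√Λ_j)`
  have ha : S.a j = Real.exp 1 * S.Csl * (N / S.β) / (S.A * (S.scale j ^ 2 * Real.sqrt (S.scale j))) := by
    simp only [a, alp, if_neg hj, if_pos hjK, hκ2]
    have := h.A_pos
    field_simp
  rw [ha, E₂]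
  have := h.Csl_pos; have := h.A_pos
  calc Real.exp 1 * S.Csl * (N / S.β) / (S.A * (S.scale j ^ 2 * Real.sqrt (S.scale j))) * S.lam j
      ≤ Real.exp 1 * S.Csl * (N / S.β) / (S.A * (S.scale j ^ 2 * Real.sqrt (S.scale j))) * (S.E₁ * ‖S.u‖ * S.scale j ^ 2 * (S.β / N)) :=
        mul_le_mul_of_nonneg_left hlam (by positivity)
    _ = Real.exp 1 * S.Csl * S.E₁ / S.A * ‖S.u‖ / Real.sqrt (S.scale j) := by field_simp

/-! ### The pollution: the geometric invariant -/

/-- `Γ′ = (11/10) e g r²√r`; `2r ≤ Γ′ ≤ (3/5) r²`. [cite: BenfattoGiulianiMastropietro2006, §2.8 (2.88)] -/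
theorem gammaPrime_bounds : 2 * flowR ≤ 11 / 10 * (Real.exp 1 * flowG * (flowR ^ 2 * flowSqr)) ∧
    11 / 10 * (Real.exp 1 * flowG * (flowR ^ 2 * flowSqr)) ≤ 3 / 5 * flowR ^ 2 := by
  refine ⟨?_, by have := flow_growth_le; linarith [show flowR ^ 2 * flowSqr = flowSqr * flowR ^ 2 by ring]⟩
  -- `e g r √r ≥ e x̄² r√r = e (4e⁴/r) r √r /… `: use `g ≥ x̄² = 4e⁴/r` and `√r = 8e⁵`
  have hg : flowX ^ 2 ≤ flowG := by
    rw [flowG, le_div_iff₀ (by linarith [flowX_sq_lt_one])]; nlinarith [sq_nonneg flowX, flowX_sq_lt_one]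
  have hx2 : flowX ^ 2 * flowR = 4 * Real.exp 4 := by
    rw [flowX_eq, flowR, div_pow]; have := flowSqr_pos; field_simp; rw [← Real.exp_nat_mul]; norm_num
  have h1 : Real.exp 1 * flowG * (flowR ^ 2 * flowSqr) ≥ Real.exp 1 * (4 * Real.exp 4) * (flowR * flowSqr) := by
    have hgr : flowG * flowR ≥ 4 * Real.exp 4 := by nlinarith [hg, flowR_pos]
    have hpos : 0 ≤ Real.exp 1 * flowR * flowSqr := by have := flowR_pos; have := flowSqr_pos; positivity
    calc Real.exp 1 * (4 * Real.exp 4) * (flowR * flowSqr) = (4 * Real.exp 4) * (Real.exp 1 * flowR * flowSqr) := by ring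
      _ ≤ (flowG * flowR) * (Real.exp 1 * flowR * flowSqr) := mul_le_mul_of_nonneg_right hgr hpos
      _ = Real.exp 1 * flowG * (flowR ^ 2 * flowSqr) := by ring
  have h2 : Real.exp 1 * (4 * Real.exp 4) * flowSqr ≥ 2 := by
    rw [flowSqr]
    have := Real.one_le_exp (show (0:ℝ) ≤ 1 by norm_num)
    have := Real.one_le_exp (show (0:ℝ) ≤ 4 by norm_num)
    have := Real.one_le_exp (show (0:ℝ) ≤ 5 by norm_num)
    nlinarith [mul_nonneg (Real.exp_pos 1).le (Real.exp_pos 4).le, mul_nonneg (mul_nonneg (Real.exp_pos 1).le (Real.exp_pos 4).le) (Real.exp_pos 5).le]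
  nlinarith [flowR_pos, h1, h2]

/-- `Γ′ = (11/10) e g r²√r`. [cite: BenfattoGiulianiMastropietro2006, §2.8 (2.88)] -/
def Gp : ℝ := 11 / 10 * (Real.exp 1 * flowG * (flowR ^ 2 * flowSqr))

/-- `q = r/Γ′`. [cite: BenfattoGiulianiMastropietro2006, §2.8 (2.88)] -/
def qq : ℝ := flowR / Gp

/-- `Ū₁ = (30/29) Γ̄₀ E₄² ‖u‖²`. [cite: BenfattoGiulianiMastropietro2006, §2.8 (2.88)] -/
def Ub : ℝ := 30 / 29 * S.Gam0 * S.E₄ ^ 2 * ‖S.u‖ ^ 2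

/-- `W = (60/11) E₂² ‖u‖² (β/π) r/r^K`. [cite: BenfattoGiulianiMastropietro2006, §2.8 (2.88)] -/
def Wsrc : ℝ := 60 / 11 * S.E₂ ^ 2 * ‖S.u‖ ^ 2 * (S.β / Real.pi) * flowR / flowR ^ S.K

/-- Bookkeeping (positivity / algebra of the budget). [cite: BenfattoGiulianiMastropietro2006, §2.8 (2.88)] -/
theorem Gp_pos : 0 < Gp := lt_of_lt_of_le (by linarith [flowR_pos]) gammaPrime_bounds.1

/-- Bookkeeping (positivity / algebra of the budget). [cite: BenfattoGiulianiMastropietro2006, §2.8 (2.88)] -/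
theorem qq_le_half : qq ≤ 1 / 2 := by
  rw [qq, div_le_iff₀ Gp_pos]; have := gammaPrime_bounds.1; rw [Gp]; linarith

/-- Bookkeeping (positivity / algebra of the budget). [cite: BenfattoGiulianiMastropietro2006, §2.8 (2.88)] -/
theorem qq_nonneg : 0 ≤ qq := div_nonneg flowR_pos.le Gp_pos.le

omit [NeZero N] in
/-- Bookkeeping (positivity / algebra of the budget). [cite: BenfattoGiulianiMastropietro2006, §2.8 (2.88)] -/
theorem Valid.E₂_nonneg (h : S.Valid) : 0 ≤ S.E₂ := by have := h.Csl_pos; have := h.A_pos; unfold E₂ E₁; positivity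

omit [NeZero N] in
/-- Bookkeeping (positivity / algebra of the budget). [cite: BenfattoGiulianiMastropietro2006, §2.8 (2.88)] -/
theorem Valid.E₄_nonneg (h : S.Valid) : 0 ≤ S.E₄ := by
  have := h.Cuv_pos; have := h.κ₀_pos; have := h.τ₀_nonneg; unfold E₄ W0; positivity

omit [NeZero N] in
/-- Bookkeeping (positivity / algebra of the budget). [cite: BenfattoGiulianiMastropietro2006, §2.8 (2.88)] -/
theorem Valid.Gam0_nonneg (h : S.Valid) : 0 ≤ S.Gam0 := by
  have := h.Csl_pos; have := h.Cuv_pos; have := h.A_pos; have := h.κ₀_pos; have := h.Λ₀_pos; have := flowG_pos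
  have := flowR_pos; have := flowSqr_pos
  unfold Gam0; positivity

omit [NeZero N] in
/-- Bookkeeping (positivity / algebra of the budget). [cite: BenfattoGiulianiMastropietro2006, §2.8 (2.88)] -/
theorem Valid.Ub_nonneg (h : S.Valid) : 0 ≤ S.Ub := by have := h.Gam0_nonneg; unfold Ub; positivity

omit [NeZero N] in
/-- Bookkeeping (positivity / algebra of the budget). [cite: BenfattoGiulianiMastropietro2006, §2.8 (2.88)] -/
theorem Valid.Wsrc_nonneg (h : S.Valid) : 0 ≤ S.Wsrc := by have := h.β_pos; have := flowR_pos; unfold Wsrc; positivity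

/-- Bookkeeping (positivity / algebra of the budget). [cite: BenfattoGiulianiMastropietro2006, §2.8 (2.88)] -/
theorem Valid.U_nonneg (h : S.Valid) (j : ℕ) : 0 ≤ S.U j := by
  have := h.a_pos j; have := h.P_nonneg j; have := flowG_pos; unfold U; positivity

omit [NeZero N] in
/-- **The global smallness**: `Γ′^{K-1}(Ū₁ + W) ≤ κ_U² E₆ ≤ 1/60` (`r^{K-1} ≤ Λ₀β/π`, `Γ′ ≤ (3/5)r²`, `(β/π)r/r^K ≤ r/Λ₀`).
[cite: BenfattoGiulianiMastropietro2006, §2.8 (2.88)] -/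
theorem Valid.global_small (h : S.Valid) : Gp ^ (S.K - 1) * (S.Ub + S.Wsrc) ≤ 1 / 60 := by
  have hβ := h.β_pos
  have hK : 1 ≤ S.K := Nat.one_le_iff_ne_zero.2 h.K_ne_zero
  have hrK : flowR ^ (S.K - 1) ≤ S.Λ₀ * S.β / Real.pi := by
    have := h.top_le
    rw [scale, gridScale_of_ne_zero S.β S.Λ₀ flowR S.K one_ne_zero] at this
    rw [le_div_iff₀ Real.pi_pos]
    have h' := mul_le_mul_of_nonneg_left this hβ.le
    calc flowR ^ (S.K - 1) * Real.pi = S.β * (Real.pi / S.β * flowR ^ (S.K - 1)) := by field_simp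
      _ ≤ S.β * S.Λ₀ := h'
      _ = S.Λ₀ * S.β := mul_comm _ _
  have hrK' : S.β / Real.pi * flowR / flowR ^ S.K ≤ flowR / S.Λ₀ := by
    have := h.le_top
    rw [scale, gridScale_of_ne_zero S.β S.Λ₀ flowR S.K one_ne_zero, show flowR * (Real.pi / S.β * flowR ^ (S.K - 1)) =
      Real.pi / S.β * flowR ^ S.K by rw [← mul_assoc, mul_comm flowR, mul_assoc, ← pow_succ', Nat.sub_add_cancel hK]] at this
    have hΛ₀ := h.Λ₀_pos
    have hrKpos : 0 < flowR ^ S.K := pow_pos flowR_pos _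
    rw [div_le_div_iff₀ hrKpos hΛ₀]
    have h' := mul_le_mul_of_nonneg_left this (show 0 ≤ S.β / Real.pi * flowR by have := flowR_pos; positivity)
    calc S.β / Real.pi * flowR * S.Λ₀ ≤ S.β / Real.pi * flowR * (Real.pi / S.β * flowR ^ S.K) := h'
      _ = flowR * flowR ^ S.K := by field_simp
  have h1 : Gp ^ (S.K - 1) ≤ (S.Λ₀ * S.β / Real.pi) ^ 2 := by
    have hhi := gammaPrime_bounds.2
    calc Gp ^ (S.K - 1) ≤ (3 / 5 * flowR ^ 2) ^ (S.K - 1) := pow_le_pow_left₀ Gp_pos.le hhi _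
      _ ≤ (flowR ^ 2) ^ (S.K - 1) := pow_le_pow_left₀ (by positivity) (by nlinarith [pow_pos flowR_pos 2]) _
      _ = (flowR ^ (S.K - 1)) ^ 2 := by rw [← pow_mul, ← pow_mul, mul_comm]
      _ ≤ (S.Λ₀ * S.β / Real.pi) ^ 2 := pow_le_pow_left₀ (pow_nonneg flowR_pos.le _) hrK 2
  have hu2 : ‖S.u‖ ^ 2 * S.β ^ 2 ≤ S.κU ^ 2 := by
    have := h.u_le; rw [le_div_iff₀ hβ] at this
    calc ‖S.u‖ ^ 2 * S.β ^ 2 = (‖S.u‖ * S.β) ^ 2 := by ring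
      _ ≤ S.κU ^ 2 := pow_le_pow_left₀ (by positivity) this 2
  have hΛ₀ := h.Λ₀_pos
  have hG := h.Gam0_nonneg
  calc Gp ^ (S.K - 1) * (S.Ub + S.Wsrc) ≤ (S.Λ₀ * S.β / Real.pi) ^ 2 * (S.Ub + S.Wsrc) :=
        mul_le_mul_of_nonneg_right h1 (add_nonneg h.Ub_nonneg h.Wsrc_nonneg)
    _ = (S.Λ₀ / Real.pi) ^ 2 * (30 / 29 * S.Gam0 * S.E₄ ^ 2) * (‖S.u‖ ^ 2 * S.β ^ 2) +
          (S.Λ₀ / Real.pi) ^ 2 * (60 / 11 * S.E₂ ^ 2) * (‖S.u‖ ^ 2 * S.β ^ 2) * (S.β / Real.pi * flowR / flowR ^ S.K) := by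
        rw [Ub, Wsrc]; ring
    _ ≤ (S.Λ₀ / Real.pi) ^ 2 * (30 / 29 * S.Gam0 * S.E₄ ^ 2) * S.κU ^ 2 +
          (S.Λ₀ / Real.pi) ^ 2 * (60 / 11 * S.E₂ ^ 2) * S.κU ^ 2 * (flowR / S.Λ₀) := by
        have : 0 ≤ S.β / Real.pi * flowR / flowR ^ S.K := by have := flowR_pos; positivity
        gcongr
    _ = S.κU ^ 2 * S.E₆ := by rw [E₆]; field_simp
    _ ≤ 1 / 60 := h.small₂

/-- `σ_j ≤ 1/60` and `σ_j² ≤ E₂²‖u‖²/Λ_j` on the slices. [cite: BenfattoGiulianiMastropietro2006, §2.8 (2.88)] -/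
theorem Valid.sigma_small (h : S.Valid) {j : ℕ} (hj : j ≠ 0) (hjK : j ≤ S.K) :
    S.a j * S.lam j ≤ 1 / 60 ∧ (S.a j * S.lam j) ^ 2 ≤ S.E₂ ^ 2 * ‖S.u‖ ^ 2 / S.scale j := by
  have hβ := h.β_pos
  have hs := sigma_le h hj hjK
  have hΛ := h.scale_pos j
  have hsq : 0 < Real.sqrt (S.scale j) := Real.sqrt_pos.2 hΛ
  have hE2 := h.E₂_nonneg
  have hσ0' : 0 ≤ S.a j * S.lam j := mul_nonneg (h.a_pos j).le (h.lam_nonneg j)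
  refine ⟨hs.trans ?_, ?_⟩
  · have hΛπ : Real.pi / S.β ≤ S.scale j := pi_div_le_gridScale hβ S.Λ₀ S.K hj
    have h1 : Real.sqrt Real.pi ≤ Real.sqrt (S.scale j) * S.β := by
      have : Real.pi ≤ S.scale j * S.β ^ 2 := by
        have h1 := (div_le_iff₀ hβ).1 hΛπ
        have h2 : S.scale j * S.β ≤ S.scale j * S.β ^ 2 := by
          rw [sq, ← mul_assoc]; exact le_mul_of_one_le_right (by positivity) h.one_le_β
        linarith
      calc Real.sqrt Real.pi ≤ Real.sqrt (S.scale j * S.β ^ 2) := Real.sqrt_le_sqrt this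
        _ = Real.sqrt (S.scale j) * S.β := by rw [Real.sqrt_mul hΛ.le, Real.sqrt_sq hβ.le]
    have h2 : S.E₂ * ‖S.u‖ / Real.sqrt (S.scale j) ≤ S.E₂ * S.κU / Real.sqrt Real.pi := by
      rw [div_le_div_iff₀ hsq (Real.sqrt_pos.2 Real.pi_pos)]
      calc S.E₂ * ‖S.u‖ * Real.sqrt Real.pi ≤ S.E₂ * (S.κU / S.β) * (Real.sqrt (S.scale j) * S.β) :=
            mul_le_mul (mul_le_mul_of_nonneg_left h.u_le hE2) h1 (Real.sqrt_nonneg _) (by have := h.κU_nonneg; positivity)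
        _ = S.E₂ * S.κU * Real.sqrt (S.scale j) := by field_simp
    refine h2.trans ?_
    have hE4 := h.E₄_nonneg
    calc S.E₂ * S.κU / Real.sqrt Real.pi = S.κU * (S.E₂ / Real.sqrt Real.pi) := by ring
      _ ≤ S.κU * (S.E₄ + S.E₂ / Real.sqrt Real.pi) := by nlinarith [h.κU_nonneg]
      _ ≤ 1 / 60 := h.small₁
  · calc (S.a j * S.lam j) ^ 2 ≤ (S.E₂ * ‖S.u‖ / Real.sqrt (S.scale j)) ^ 2 := pow_le_pow_left₀ hσ0' hs 2
      _ = S.E₂ ^ 2 * ‖S.u‖ ^ 2 / S.scale j := by rw [div_pow, mul_pow, Real.sq_sqrt hΛ.le]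

/-- `σ_0 ≤ 1/60`. [cite: BenfattoGiulianiMastropietro2006, §2.8 (2.88)] -/
theorem Valid.sigma_zero_small (h : S.Valid) : S.a 0 * S.lam 0 ≤ 1 / 60 := by
  refine (sigma_zero_le h).trans ?_
  have hE4 := h.E₄_nonneg
  have hE2 : 0 ≤ S.E₂ / Real.sqrt Real.pi := by have := h.E₂_nonneg; positivity
  calc S.E₄ * ‖S.u‖ ≤ S.E₄ * S.κU := mul_le_mul_of_nonneg_left h.norm_u_le hE4
    _ ≤ S.κU * (S.E₄ + S.E₂ / Real.sqrt Real.pi) := by nlinarith [h.κU_nonneg]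
    _ ≤ 1 / 60 := h.small₁

/-- **The first step of the pollution**: `U_1 ≤ Ū₁`. [cite: BenfattoGiulianiMastropietro2006, §2.8 (2.88)] -/
theorem Valid.U_one_le (h : S.Valid) : S.U 1 ≤ S.Ub := by
  rw [U_succ h 0]
  simp only [U_zero, zero_add, Theta_eq_add, add_zero]
  have hσ00 : 0 ≤ S.a 0 * S.lam 0 := mul_nonneg (h.a_pos 0).le (h.lam_nonneg 0)
  have hσsq : (S.a 0 * S.lam 0) ^ 2 ≤ S.E₄ ^ 2 * ‖S.u‖ ^ 2 := by
    rw [← mul_pow]; exact pow_le_pow_left₀ hσ00 (sigma_zero_le h) 2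
  have hε : (1 : ℝ) - flowEps = 29 / 30 := by rw [flowEps]; norm_num
  rw [hε, Ub]
  have hG := h.Gam0_nonneg
  calc Real.exp 1 * flowG * S.a 1 / S.a 0 * ((S.a 0 * S.lam 0) ^ 2 / (29 / 30)) ≤ S.Gam0 * (S.E₄ ^ 2 * ‖S.u‖ ^ 2 / (29 / 30)) :=
        mul_le_mul (a_one_le h) (by gcongr) (by positivity) hG
    _ = 30 / 29 * S.Gam0 * S.E₄ ^ 2 * ‖S.u‖ ^ 2 := by ring

/-- **The inductive step of the pollution**: from the invariant at `j` (`1 ≤ j`, `j + 1 ≤ K`) to `j + 1`.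
[cite: BenfattoGiulianiMastropietro2006, §2.8 (2.88)] -/
theorem Valid.U_step (h : S.Valid) {j : ℕ} (hj : j ≠ 0) (hjK : j + 1 ≤ S.K)
    (ihU : S.U j ≤ Gp ^ (j - 1) * (S.Ub + S.Wsrc * (1 - qq ^ (j - 1)))) (ihU60 : S.U j ≤ 1 / 60) :
    S.U (j + 1) ≤ Gp ^ j * (S.Ub + S.Wsrc * (1 - qq ^ j)) := by
  have hβ := h.β_pos
  have hjpos : 0 < j := Nat.pos_of_ne_zero hj
  have hjK' : j ≤ S.K := by omega
  obtain ⟨hσj, hσj2⟩ := h.sigma_small hj hjK'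
  have hUj0 := h.U_nonneg j
  set σ := S.a j * S.lam j with hσdef
  set Γ := Real.exp 1 * flowG * (flowR ^ 2 * flowSqr) with hΓ
  have hΓ0 : 0 ≤ Γ := by rw [hΓ]; have := flowG_pos; have := flowR_pos; have := flowSqr_pos; positivity
  have hGp : Gp = 11 / 10 * Γ := by rw [Gp, hΓ]
  have hσ0' : 0 ≤ σ := mul_nonneg (h.a_pos j).le (h.lam_nonneg j)
  -- the step: `U_{j+1} = Γ (U_j + Θ_j²/(1-ε)) ≤ Γ′ U_j + 3 Γ σ_j²`
  have hΓeq : Real.exp 1 * flowG * S.a (j + 1) / S.a j = Γ := by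
    rw [a_succ_eq h hj hjK]; have := (h.a_pos j).ne'; rw [hΓ]; field_simp
  have hstep : S.U (j + 1) ≤ Gp * S.U j + 3 * Γ * (S.E₂ ^ 2 * ‖S.u‖ ^ 2 / S.scale j) := by
    rw [U_succ h j, hΓeq, Theta_eq_add, ← hσdef]
    have hε : (1 : ℝ) - flowEps = 29 / 30 := by rw [flowEps]; norm_num
    rw [hε]
    have ha : (σ + S.U j) ^ 2 ≤ 2 * σ ^ 2 + 2 * S.U j ^ 2 := by nlinarith [sq_nonneg (σ - S.U j)]
    have hb : S.U j ^ 2 ≤ S.U j / 60 := by nlinarith [mul_le_mul_of_nonneg_left ihU60 hUj0]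
    have hsq : (σ + S.U j) ^ 2 / (29 / 30) ≤ 60 / 29 * σ ^ 2 + 1 / 29 * S.U j := by
      rw [div_le_iff₀ (by norm_num)]; linarith
    calc Γ * (S.U j + (σ + S.U j) ^ 2 / (29 / 30)) ≤ Γ * (S.U j + (60 / 29 * σ ^ 2 + 1 / 29 * S.U j)) := by gcongr
      _ = (30 / 29 * Γ) * S.U j + 60 / 29 * Γ * σ ^ 2 := by ring
      _ ≤ Gp * S.U j + 3 * Γ * (S.E₂ ^ 2 * ‖S.u‖ ^ 2 / S.scale j) := by
          refine add_le_add (mul_le_mul_of_nonneg_right (by rw [hGp]; nlinarith) hUj0) ?_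
          have : 0 ≤ Γ * (S.E₂ ^ 2 * ‖S.u‖ ^ 2 / S.scale j) := by have := h.scale_pos j; positivity
          calc 60 / 29 * Γ * σ ^ 2 ≤ 60 / 29 * Γ * (S.E₂ ^ 2 * ‖S.u‖ ^ 2 / S.scale j) := by gcongr
            _ ≤ 3 * Γ * (S.E₂ ^ 2 * ‖S.u‖ ^ 2 / S.scale j) := by nlinarith
  -- the source in geometric form: `1/Λ_j = (β/π) r^j / r^K`
  have hsource : S.E₂ ^ 2 * ‖S.u‖ ^ 2 / S.scale j = S.E₂ ^ 2 * ‖S.u‖ ^ 2 * (S.β / Real.pi) * flowR ^ j / flowR ^ S.K := by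
    rw [scale, gridScale_of_ne_zero S.β S.Λ₀ flowR S.K hj]
    have hr := flowR_pos
    have : flowR ^ S.K = flowR ^ (S.K - j) * flowR ^ j := by rw [← pow_add, Nat.sub_add_cancel hjK']
    rw [this]; field_simp
  refine hstep.trans ?_
  rw [hsource]
  have hGp0 := Gp_pos
  have hq0 := qq_nonneg
  have hq2 := qq_le_half
  have hΓ'j : Gp ^ j = Gp * Gp ^ (j - 1) := by rw [← pow_succ', Nat.sub_add_cancel hjpos]
  -- `Γ′ U_j ≤ Γ′^j (Ub + W(1 - q^{j-1}))`
  have h1 : Gp * S.U j ≤ Gp ^ j * (S.Ub + S.Wsrc * (1 - qq ^ (j - 1))) := by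
    rw [hΓ'j, mul_assoc]; exact mul_le_mul_of_nonneg_left ihU hGp0.le
  -- the source fits in `Γ′^j W (q^{j-1} - q^j) = Γ′ r^{j-1} W (1 - q)`
  have hqj : Gp ^ j * qq ^ (j - 1) = Gp * flowR ^ (j - 1) := by
    rw [hΓ'j, qq, div_pow]
    have := pow_ne_zero (j - 1) hGp0.ne'
    field_simp
  have hexpand : Gp ^ j * (S.Wsrc * (qq ^ (j - 1) - qq ^ j)) = Gp * flowR ^ (j - 1) * S.Wsrc * (1 - qq) := by
    have : qq ^ j = qq ^ (j - 1) * qq := by rw [← pow_succ, Nat.sub_add_cancel hjpos]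
    rw [this, show Gp ^ j * (S.Wsrc * (qq ^ (j - 1) - qq ^ (j - 1) * qq)) = (Gp ^ j * qq ^ (j - 1)) * S.Wsrc * (1 - qq) by ring, hqj]
  have h2 : 3 * Γ * (S.E₂ ^ 2 * ‖S.u‖ ^ 2 * (S.β / Real.pi) * flowR ^ j / flowR ^ S.K) ≤ Gp ^ j * (S.Wsrc * (qq ^ (j - 1) - qq ^ j)) := by
    rw [hexpand, Wsrc]
    have hrj : flowR ^ j = flowR * flowR ^ (j - 1) := by rw [← pow_succ', Nat.sub_add_cancel hjpos]
    rw [hrj, show (3 : ℝ) * Γ = 30 / 11 * Gp by rw [hGp]; ring]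
    have h1q : 1 / 2 ≤ 1 - qq := by linarith
    have hpos : 0 ≤ Gp * flowR ^ (j - 1) * (S.E₂ ^ 2 * ‖S.u‖ ^ 2 * (S.β / Real.pi) * flowR / flowR ^ S.K) := by
      have := flowR_pos; positivity
    calc 30 / 11 * Gp * (S.E₂ ^ 2 * ‖S.u‖ ^ 2 * (S.β / Real.pi) * (flowR * flowR ^ (j - 1)) / flowR ^ S.K)
        = (30 / 11) * (Gp * flowR ^ (j - 1) * (S.E₂ ^ 2 * ‖S.u‖ ^ 2 * (S.β / Real.pi) * flowR / flowR ^ S.K)) := by ring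
      _ ≤ (60 / 11 * (1 - qq)) * (Gp * flowR ^ (j - 1) * (S.E₂ ^ 2 * ‖S.u‖ ^ 2 * (S.β / Real.pi) * flowR / flowR ^ S.K)) :=
          mul_le_mul_of_nonneg_right (by linarith) hpos
      _ = Gp * flowR ^ (j - 1) * (60 / 11 * S.E₂ ^ 2 * ‖S.u‖ ^ 2 * (S.β / Real.pi) * flowR / flowR ^ S.K) * (1 - qq) := by ring
  calc Gp * S.U j + 3 * Γ * (S.E₂ ^ 2 * ‖S.u‖ ^ 2 * (S.β / Real.pi) * flowR ^ j / flowR ^ S.K)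
      ≤ Gp ^ j * (S.Ub + S.Wsrc * (1 - qq ^ (j - 1))) + Gp ^ j * (S.Wsrc * (qq ^ (j - 1) - qq ^ j)) := add_le_add h1 h2
    _ = Gp ^ j * (S.Ub + S.Wsrc * (1 - qq ^ j)) := by ring

/-- **The geometric invariant of the pollution**: for `1 ≤ j ≤ K`, `U_j ≤ Γ′^{j-1}(Ū₁ + W(1 - q^{j-1}))` and `U_j ≤ 1/60`.
[cite: BenfattoGiulianiMastropietro2006, §2.8 (2.88)] -/
theorem Valid.U_le (h : S.Valid) : ∀ j, j ≠ 0 → j ≤ S.K →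
    S.U j ≤ Gp ^ (j - 1) * (S.Ub + S.Wsrc * (1 - qq ^ (j - 1))) ∧ S.U j ≤ 1 / 60 := by
  have hsmall := h.global_small
  have hGp1 : 1 ≤ Gp := by have := gammaPrime_bounds.1; rw [Gp]; linarith [two_le_flowR]
  have hq0 := qq_nonneg
  have hq1 : qq ≤ 1 := by linarith [qq_le_half]
  have hUb := h.Ub_nonneg
  have hW := h.Wsrc_nonneg
  -- from the invariant to `≤ 1/60`
  have hto60 : ∀ j, j ≠ 0 → j ≤ S.K → S.U j ≤ Gp ^ (j - 1) * (S.Ub + S.Wsrc * (1 - qq ^ (j - 1))) → S.U j ≤ 1 / 60 := by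
    intro j _ hjK hU
    refine hU.trans (le_trans ?_ hsmall)
    have h1 : Gp ^ (j - 1) ≤ Gp ^ (S.K - 1) := pow_le_pow_right₀ hGp1 (by omega)
    have h2 : S.Ub + S.Wsrc * (1 - qq ^ (j - 1)) ≤ S.Ub + S.Wsrc := by nlinarith [pow_nonneg hq0 (j - 1)]
    have h3 : 0 ≤ S.Ub + S.Wsrc * (1 - qq ^ (j - 1)) := by nlinarith [pow_le_one₀ hq0 hq1 (n := j - 1)]
    exact mul_le_mul h1 h2 h3 (pow_nonneg (by linarith) _)
  intro j hj hjK
  induction j with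
  | zero => exact absurd rfl hj
  | succ j ih =>
    rcases Nat.eq_zero_or_pos j with rfl | hjpos
    · have hU1 := h.U_one_le
      have hinv : S.U 1 ≤ Gp ^ (1 - 1) * (S.Ub + S.Wsrc * (1 - qq ^ (1 - 1))) := by simpa using hU1
      exact ⟨hinv, hto60 1 one_ne_zero hjK hinv⟩
    · have hj0 : j ≠ 0 := by omega
      obtain ⟨ihU, ihU60⟩ := ih hj0 (by omega)
      have hinv := h.U_step hj0 hjK ihU ihU60
      refine ⟨by simpa only [Nat.add_sub_cancel] using hinv, hto60 (j + 1) hj hjK ?_⟩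
      simpa only [Nat.add_sub_cancel] using hinv

/-- **Every `Θ_j` stays below `ε = 1/30`** (`j ≤ K`): hypothesis `hsmall` of `flowD_budget_quadratic`.
[cite: BenfattoGiulianiMastropietro2006, §2.8 (2.88)] -/
theorem theta_le (h : S.Valid) {j : ℕ} (hjK : j ≤ S.K) :
    Real.exp 1 * S.alp j * (S.lam j + S.P j * flowX ^ 2 / (1 - flowX ^ 2)) / S.kap j ^ 2 ≤ flowEps := by
  rw [Theta_eq, Theta_eq_add, flowEps]
  rcases Nat.eq_zero_or_pos j with rfl | hj
  · rw [U_zero, add_zero]; linarith [h.sigma_zero_small]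
  · have hj0 : j ≠ 0 := by omega
    linarith [(h.U_le j hj0 hjK).2, (h.sigma_small hj0 hjK).1]

end FlowSetup

end Literature.MathematicalPhysics.QuantumLattice

end
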